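import Summits.QuantumFields.YangMills.Theses.UnitScaleTilt
import Literature.MathematicalPhysics.QuantumFieldTheory.Balaban1983to89.T3LowerActionSplit
import Literature.MathematicalPhysics.QuantumFieldTheory.Balaban1983to89.T3ExistSplit
import Summits.QuantumFields.YangMills.Theorems.UnitScaleTiltMinimiserStabilityRegPrAvgActionDefect
import Summits.QuantumFields.YangMills.Theorems.UnitScaleTiltMinimiserStabilityRegPrAvgCurvGrad
import Summits.QuantumFields.YangMills.Theorems.UnitScaleTiltMinimiserStabilityRegPrThm1Induction
import HarnessLib

/-!
# BC3 birth skeleton, LAYER-4 v4 (route owner ym3-torus-plan gen 14, 2026-08-26T13:xxZ) — crux `MinimiserStabilityRegPr` (route `UnitScaleTilt`,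
# stmt-QuantumFields-19200, K1aR-pr): v3d (511ba6194f4d04b9) with its ONE variational block `stub_variational` RE-CUT BY NAME — theorem-backed by
# ★ym-ust-19200-p1's ACCEPTED p444663 `Variational.stub_variational_of_leaves` ([7] Thm 1 at every d = 3 carrier by the printed Sect. A induction,
# architecture discharged, `thm1At_fam_of_prop7_prop8_sectF`) — into the FOUR printed ∕ located leaves it consumes (fleet LINE №71, director's
# recommendation; census = evidence #22 on 19200): V2 `stub_prop8` ([7] Prop 8, PRINTED), V3 `stub_prop7From14` ([7] Prop 7 from a background (14),
# Sects. B–E, PRINTED), V4 `stub_sectF` ([7] Sect. F (152)–(169), PRINTED; GAP G-B11-F3), V5 `stub_minSixAttained` ((142) + Sect. C attainment over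
# (6)(ε₀), located G-K1aR-2′); `stub_smoothLift` UNCHANGED (byte-identical to v3d); the two landed lattice-geometry statements stay discharged from the
# tree (p440643, p437535).  Five registered stubs ≤ 7, no shred: each new stub is a multi-section theorem of [Balaban1985Variational] for the family's
# (0.4)-averaging variational problem at the carriers `T3Thm1Carrier.famX L`.

TYPING DECISION (the shared constant B₃).  p444663's hypothesis binds ONE `B₃ > 4` shared by the four leaves (`∃ B₃, 4 < B₃ ∧ H7 ∧ Prop8 ∧ SectF ∧
attainment`).  As separate stubs: V2 PRODUCES it (`∃ B₃, 4 < B₃ ∧ Prop8Printed B₃ (famX L)` — Prop 8's conclusion `InU (B₃ε₁)` is monotone in B₃, so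
print's constant may be enlarged past 4), and V3 ∕ V4 ∕ V5 are asked at EVERY `B₃ > 4` with their own constants AFTER B₃ (`∃ a₀ a₁' O₁` ∕ `∃ a₁ B₄ RM`
∕ `∃ â₀ â₁` follow `∀ B₃`), which is print's reading «for ε₁ sufficiently small depending on B₃» (p.304: a₁ «a largest constant such that ε₁ ≤ a₁
implies all the other restrictions»; (169): M′B₃ε₁ ≤ a₅); V5 is even monotone-weaker in B₃ (its hypothesis `B₃ε₁ ≤ ε₀` tightens).  If a prover
locates a leaf in print only on a B₃-range, the owner re-cuts to `∃ B₃⁰, ∀ B₃ ≥ B₃⁰` forms (V2 then produces B₃ above any bound, free by monotonicity).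

THE LINE (unchanged below the variational block).  `MinimiserStabilityRegPrAt` ⇐ EXIST ∧ UPPER ∧ LOWER (`minimiserStabilityRegPrAt_of_alongRegPrMinimisers`,
p415649); EXIST ⇐ `MinSixAttainedAt` (`T3ExistSplit.hasRegMinimisersPrAt_of_attained`, p429517); UPPER ⇐ `MinimisersIn8At ∧ MinimiserCurvGradAt ∧
SmoothLiftAt` (`T3UpperLiftSplit.upperAlongRegPrMinimisersAt_of_split'`, p428198); LOWER ⇐ `MinimisersIn8At ∧ MinimiserCurvGradAt ∧ AvgCurvGradAt ∧
AvgActionDefectAt` (`T3LowerActionSplit.lowerAlongRegPrMinimisersAt_of_split'''`, p428884); and NOW the variational triple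
`MinSixAttainedAt ∧ MinimisersIn8At ∧ MinimiserCurvGradAt` ⇐ V2 ∧ V3 ∧ V4 ∧ V5 (`variational_of_leaves` below := p444663 ∘ p443485).  `m₀ = 10`.
* `stub_prop8` — V2: ∃ B₃ > 4, `B11.Prop8Printed B₃ (T3Thm1Carrier.famX L)` (critical configurations of (5) in (6)(ε₀), ε₀ ≤ a₅, lie in (8)(B₃ε₁)).
* `stub_prop7From14` — V3: ∀ B₃ > 4, Prop 7 from a background 𝔘(L³B₃ε₁) ∩ 𝔅(V) (C₁ = L³, O₁ ≥ 1): at most one critical orbit in (6)(ε₀) for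
  B₃ε₁ ≤ ε₀ ≤ a₀, and a minimal orbit in 𝔘(O₁L³B₃ε₁) for ε₁ ≤ a₁′ — needs the positivity of the linearised operator ([Balaban1985BackgroundPropagators]
  Thm 3.11∕3.12, tree `B9.Thm311Printed`).
* `stub_sectF` — V4: ∀ B₃ > 4, `B11.SectFPrinted B₃ (famX L)` ((9)–(10) at cubes for critical configurations in (8)(B₃ε₁); GAP G-B11-F3: the Hölder clause).
* `stub_minSixAttained` — V5: ∀ B₃ > 4, ∃ â₀ â₁ > 0, `T3ExistSplit.MinSixAttainedAt L â₀ â₁ B₃` (the Wilson action attains its infimum over (6)(ε₀)).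
* `stub_smoothLift` — G-K1a-2′ `SmoothLiftAt L C₁ C₂ c` (unchanged; located content = the smooth stratum 0 ≤ b < a via `SmoothLift.smoothLiftAt_of_smooth`,
  rough half landed p441624).
* `landed_avgCurvGrad` (p440643), `landed_avgActionDefect` (p437535) — discharged from the tree, not stubs.
Opens of record for by-name landing of a stub (write the statement verbatim under these): `Balaban1983to89`, `T3ContinuumYM3Torus`, `T3Thm1Carrier`
(`Idx`, `famX`), `B11 (Prop8Printed SectFPrinted)`, `T3ExistSplit`, `T3LowerAlongMinimisersSplit`, `T3AvgDivergenceSplit`, `T3UpperLiftSplit` (see the `open` lines).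
-/

set_option autoImplicit false

noncomputable section


open MeasureTheory
open Literature.MathematicalPhysics.QuantumFieldTheory.Balaban1983to89
open Literature.MathematicalPhysics.QuantumFieldTheory.Balaban1983to89.T3ContinuumYM3Torus
open Literature.MathematicalPhysics.QuantumFieldTheory.Balaban1983to89.T3PrintedRegularMinimiser
open Literature.MathematicalPhysics.QuantumFieldTheory.Balaban1983to89.T3PrintedRegularMinimiserReduction
open Literature.MathematicalPhysics.QuantumFieldTheory.Balaban1983to89.T3PrintedMinimiserExistence
open Literature.MathematicalPhysics.QuantumFieldTheory.Balaban1983to89.T3LowerAlongMinimisersSplit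
open Literature.MathematicalPhysics.QuantumFieldTheory.Balaban1983to89.T3UpperAlongMinimisersSplit
open Literature.MathematicalPhysics.QuantumFieldTheory.Balaban1983to89.T3AvgDivergenceSplit
open Literature.MathematicalPhysics.QuantumFieldTheory.Balaban1983to89.T3UpperLiftSplit
open Literature.MathematicalPhysics.QuantumFieldTheory.Balaban1983to89.T3LowerActionSplit
open Literature.MathematicalPhysics.QuantumFieldTheory.Balaban1983to89.T3ExistSplit
open Literature.MathematicalPhysics.QuantumFieldTheory.Balaban1983to89.T3Thm1Carrier
open Literature.MathematicalPhysics.QuantumFieldTheory.Balaban1983to89.B11 (Prop8Printed SectFPrinted)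

namespace Summit.QuantumFields.YangMills.Cruxes.MinimiserStabilityRegPr.BirthLayer4v4

/-! ## §1 Registered stubs (each a genuine lemma of the line; sorries live ONLY here) -/

/-- STUB V2 — [Balaban1985Variational] PROPOSITION 8 at the d = 3 carriers, PRINTED (p. 304; proof = Sect. F pp. 300–304 with the halving iteration):
«if U is a critical configuration of (5) in the space (6) with V satisfying (7), and if ε₀ ≤ a₅, then U belongs to the space (8)» = `B11.Prop8Printed B₃
(T3Thm1Carrier.famX L)`, for SOME B₃ > 4 (print's B₃ enlarged if needed — the conclusion `InU (B₃ε₁)` is monotone in B₃; `4 < B₃` is what the k = 1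
background of the Sect. A induction wants, p444663). XL. [cite: Balaban1985Variational, Prop. 8 p.304] -/
theorem stub_prop8 : ∀ (L : ℕ), 1 < L → ∃ B₃ : ℝ, 4 < B₃ ∧ Prop8Printed B₃ (famX L) := by
  sorry

/-- STUB V3 — [Balaban1985Variational] PROPOSITION 7 FROM A BACKGROUND (14) at the d = 3 carriers, PRINTED (p. 299; Sects. B–E; T3 reading: background
`U₀ ∈ 𝔘(L³B₃ε₁) ∩ 𝔅(V)`, `C₁ = L³`, `O₁ ≥ 1`): for every B₃ > 4 there are a₀, a₁′, O₁ with — at most one critical orbit in (6)(ε₀) whenever B₃ε₁ ≤ ε₀ ≤ a₀,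
and a minimal orbit in 𝔘(O₁L³B₃ε₁) whenever ε₁ ≤ a₁′.  Needs the positivity of the linearised operator ([Balaban1985BackgroundPropagators] Thm 3.11∕3.12,
tree `B9.Thm311Printed`).  VERBATIM the hypothesis `H7` of p444663 `thm1At_fam_of_prop7_prop8_sectF`, universally in B₃ > 4. XL.
[cite: Balaban1985Variational, Prop. 7 p.299] -/
theorem stub_prop7From14 : ∀ (L : ℕ), 1 < L → ∀ B₃ : ℝ, 4 < B₃ →
    ∃ a₀ a₁' O₁ : ℝ, 0 < a₀ ∧ 0 < a₁' ∧ 1 ≤ O₁ ∧ ∀ (i : Idx L) (ε₀ ε₁ : ℝ), 0 < ε₁ → ∀ V : (famX L i).Bdry, (famX L i).Reg7 ε₁ V →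
      ∀ U₀ : (famX L i).Cfg, (famX L i).InU ((L : ℝ) ^ 3 * B₃ * ε₁) U₀ → (famX L i).InB V U₀ →
        (ε₀ ≤ a₀ → B₃ * ε₁ ≤ ε₀ → (famX L i).AtMostOneCriticalOrbit ε₀ V) ∧
        (ε₁ ≤ a₁' → ∃ U : (famX L i).Cfg, (famX L i).OnMinimalOrbit (O₁ * (L : ℝ) ^ 3 * B₃ * ε₁) V U) := by
  sorry

/-- STUB V4 — [Balaban1985Variational] SECT. F at the d = 3 carriers, PRINTED ((152)–(169) pp. 300–305: the regularity (9)–(10) at cubes for critical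
configurations in (8)(B₃ε₁), ε₁ ≤ a₁(B₃)) = `B11.SectFPrinted B₃ (T3Thm1Carrier.famX L)` for every B₃ > 4 (constants a₁, B₄, R_M after B₃; (169): M′B₃ε₁ ≤ a₅).
GAP G-B11-F3: the Hölder clause of (9) is not derived in print (at the T3 carrier: the covariant gradient of the plaquette field, reading R3). L–XL.
[cite: Balaban1985Variational, Sect. F (169) p.305] -/
theorem stub_sectF : ∀ (L : ℕ), 1 < L → ∀ B₃ : ℝ, 4 < B₃ → SectFPrinted B₃ (famX L) := by
  sorry

/-- STUB V5 — ATTAINMENT OVER THE BIG SPACE (6)(ε₀), located gap G-K1aR-2′ (printed in kind: (142) p. 299 + Sect. C coercivity over the chart (19)–(21);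
= the LQB lane's `hattain`): for every B₃ > 4 there are â₀, â₁ > 0 with `T3ExistSplit.MinSixAttainedAt L â₀ â₁ B₃` (for (7)-small V, 0 < ε₁ ≤ â₁,
B₃ε₁ ≤ ε₀ ≤ â₀, the Wilson action attains its infimum over print's regular fibre (6)(ε₀)); monotone-weaker in B₃.  Alternative by-name route: p445137
`Attainment.minSixAttainedAt_of_infSixOfEight` (⇐ `Thm1MinimalIn8At ∧ InfSixOfEightAt`). L–XL. [cite: Balaban1985Variational, Prop. 7 (142) p.299] -/
theorem stub_minSixAttained : ∀ (L : ℕ), 1 < L → ∀ B₃ : ℝ, 4 < B₃ → ∃ â₀ â₁ : ℝ, 0 < â₀ ∧ 0 < â₁ ∧ MinSixAttainedAt L â₀ â₁ B₃ := by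
  sorry

/-- STUB 6 (`stub_smoothLift`, UNCHANGED from v3d) — located gap G-K1a-2′ (per-configuration smooth EXACT one-step lift through the family's (0.4)-averaging: plaquettes `< C₁(a + b)`,
curvature gradients `≤ C₁(b + a²)`, `L·A(U″) ≤ A(U) + C₂(b² + ab + a³)L^{3(m+K)}`; UNPRINTED for non-abelian fields, abelian template
[King1986] (A.5)). [cite: King1986, (A.5) p.676] -/
theorem stub_smoothLift : ∀ (L : ℕ), ∃ C₁ C₂ c : ℝ, 0 < C₁ ∧ 0 ≤ C₂ ∧ 0 < c ∧ SmoothLiftAt L C₁ C₂ c := by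
  sorry

/-- LANDED (not a stub) — located gap G-K1a-3a′ (first-order regularity of the one-step (0.4)-average: plaquettes `≤ a ≤ c`, curvature gradients `≤ b` ⇒
the average's curvature gradients `≤ C₁b + C₂a²`; zeroth-order twin = tree `BlockAveragingPlaquetteBound.plaqSmall_blockAvg_expMeanLogSU`).
[cite: Balaban1985Averaging, Prop. 3 (122)-(123) p.36] -/
theorem landed_avgCurvGrad : ∀ (L : ℕ), ∃ C₁ C₂ c : ℝ, 0 ≤ C₁ ∧ 0 < C₂ ∧ 0 < c ∧ AvgCurvGradAt L C₁ C₂ c :=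
  Summit.QuantumFields.YangMills.Theorems.AvgCurvGrad.stub_avgCurvGrad  -- LANDED p440643 (seat ym3-torus-p1 gen 8)

/-- LANDED (not a stub) — located gap G-K1a-3b′ (per-configuration averaging action defect: plaquettes `≤ a ≤ c`, gradients `≤ b ≤ c` ⇒ `A(D_{K,K+1}U) ≤
L·A(U) + C₂(b² + ab + a³)L^{3(m+K+1)}`; the quadratic part is exact by Jensen + Cauchy–Schwarz over the `L²` translated squares).
[cite: Federbush1987PhaseCellIII, Thm 4.3 (4.5) p.299] -/
theorem landed_avgActionDefect : ∀ (L : ℕ), ∃ C₂ c : ℝ, 0 ≤ C₂ ∧ 0 < c ∧ AvgActionDefectAt L C₂ c :=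
  Summit.QuantumFields.YangMills.Theorems.AvgActionDefect.stub_avgActionDefect  -- LANDED p437535 (seat ym3-torus-p1 gen 8)

/-- **v3d's `stub_variational` FROM THE FOUR LEAVES, BY NAME** (no sorry of its own): `∀ L, ∃ a₀ a₁ B₃ B₄ > 0, MinSixAttainedAt ∧ MinimisersIn8At ∧
MinimiserCurvGradAt` := p444663 `Variational.stub_variational_of_leaves` (⇐ p443485 `stub_variational_of_printed` ∘ `thm1At_fam_of_prop7_prop8_sectF`)
fed with V2's B₃ and V3 ∕ V4 ∕ V5 at that B₃. [cite: Balaban1985Variational, Thm 1 p.279, Prop 7 p.299, Prop 8 p.304] -/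
theorem variational_of_leaves :
    ∀ (L : ℕ), ∃ a₀ a₁ B₃ B₄ : ℝ, 0 < a₀ ∧ 0 < a₁ ∧ 0 < B₃ ∧ 0 < B₄ ∧
      MinSixAttainedAt L a₀ a₁ B₃ ∧ MinimisersIn8At L a₀ a₁ B₃ ∧ MinimiserCurvGradAt L a₀ a₁ B₃ B₄ :=
  Summit.QuantumFields.YangMills.Theorems.Variational.stub_variational_of_leaves fun L hL => by
    obtain ⟨B₃, hB₃, h8⟩ := stub_prop8 L hL
    exact ⟨B₃, hB₃, stub_prop7From14 L hL B₃ hB₃, h8, stub_sectF L hL B₃ hB₃, stub_minSixAttained L hL B₃ hB₃⟩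

/-! ## §2 The composition — concludes the ROUTE DECL by name, uses the stubs through the tree's proved bridges, no sorry -/

/-- **`MinimiserStabilityRegPr ⇐ (stub_prop8 ∧ stub_prop7From14 ∧ stub_sectF ∧ stub_minSixAttained) ∧ stub_smoothLift ∧ landed_avgCurvGrad ∧ landed_avgActionDefect`**: the variational triple by `variational_of_leaves` (p444663), EXIST by
`T3ExistSplit.hasRegMinimisersPrAt_of_attained`, UPPER by `T3UpperLiftSplit.upperAlongRegPrMinimisersAt_of_split'`, LOWER by
`T3LowerActionSplit.lowerAlongRegPrMinimisersAt_of_split'''`, then `minimiserStabilityRegPrAt_of_alongRegPrMinimisers`; ε₁ := min of three,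
m₀ := 10, γ₁ := min of three; `L < 1` is vacuous (no member of the family). -/
theorem MinimiserStabilityRegPr_of : Summit.QuantumFields.YangMills.Theses.UnitScaleTilt.MinimiserStabilityRegPr := by
  intro L
  obtain ⟨a₀, a₁, B₃, B₄, ha₀, ha₁, hB₃, hB₄, hatt, hIn8, hgrad⟩ := variational_of_leaves L
  by_cases hL : 1 ≤ L
  · -- EXIST
    obtain ⟨e₁, he₁, hE⟩ := hasRegMinimisersPrAt_of_attained ha₀ ha₁ hB₃ hatt
    -- UPPER
    obtain ⟨C₁, C₂, c, hC₁, hC₂, hc, hlift⟩ := stub_smoothLift L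
    obtain ⟨e₂, he₂, hU⟩ := upperAlongRegPrMinimisersAt_of_split' ha₀ ha₁ hB₃ hB₄ hC₁ hC₂ hc hIn8 hgrad hlift
    -- LOWER
    obtain ⟨D₁, D₂, d, hD₁, hD₂, hd, havg⟩ := landed_avgCurvGrad L
    obtain ⟨E₂, e, hE₂, he, hdef⟩ := landed_avgActionDefect L
    obtain ⟨e₃, he₃, hLo⟩ := lowerAlongRegPrMinimisersAt_of_split''' hL ha₀ ha₁ hB₃ hB₄ hD₂ hd hE₂ he hIn8 hgrad havg hdef
    -- the common `ε₁`, `m₀ = 10`, `γ₁`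
    refine ⟨min e₁ (min e₂ e₃), lt_min he₁ (lt_min he₂ he₃), fun ε₀ hε hεle => ⟨10, fun m hm b₀ p₀ hb _ => ?_⟩⟩
    have hε₁ : ε₀ ≤ e₁ := hεle.trans (min_le_left _ _)
    have hε₂ : ε₀ ≤ e₂ := hεle.trans ((min_le_right _ _).trans (min_le_left _ _))
    have hε₃ : ε₀ ≤ e₃ := hεle.trans ((min_le_right _ _).trans (min_le_right _ _))
    have hm2 : 2 ≤ m := le_trans (by norm_num) hm
    obtain ⟨γa, hγa, hA⟩ := hE ε₀ hε hε₁ m hm2 b₀ p₀ hb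
    obtain ⟨γb, hγb, hB⟩ := hU ε₀ hε hε₂ m hm b₀ p₀ hb
    obtain ⟨γc, hγc, hC⟩ := hLo ε₀ hε hε₃ m hm b₀ p₀ hb
    refine ⟨min γa (min γb γc), lt_min hγa (lt_min hγb hγc), fun F γ hFL hγ hγle => ?_⟩
    have hγa' : γ ≤ γa := hγle.trans (min_le_left _ _)
    have hγb' : γ ≤ γb := hγle.trans ((min_le_right _ _).trans (min_le_left _ _))
    have hγc' : γ ≤ γc := hγle.trans ((min_le_right _ _).trans (min_le_right _ _))
    exact minimiserStabilityRegPrAt_of_alongRegPrMinimisers hγ.le (hA F γ hFL hγ hγa') (hB F γ hFL hγ hγb') (hC F γ hFL hγ hγc')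
  · -- no member of the family has block size `L < 1`
    exact ⟨1, one_pos, fun ε₀ _ _ => ⟨0, fun m _ b₀ p₀ _ _ => ⟨1, one_pos, fun F γ hFL _ _ => absurd (hFL ▸ F.hL.2.le) hL⟩⟩⟩

end Summit.QuantumFields.YangMills.Cruxes.MinimiserStabilityRegPr.BirthLayer4v4

end
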